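import Mathlib
import Summits.MatrixMultiplication.MatrixMultiplication.Theses.MatrixPointInterpolation
import Summits.MatrixMultiplication.MatrixMultiplication.Theorems.MatrixPointInterpolationPointCount
import Literature.Algebra.PolynomialIdentities.GenericMatricesGrowth

/-!
# Crux `FewPointMasquerades` (stmt-MatrixMultiplication-18199) — LINE `fast-masquerades`

Checked skeleton (crux-strategist `planner-cstrat-stmt-MatrixMultiplication-18199-0`, 2026-08-17).
The WINDOW line (W) foreseen in the route header of `Theses/MatrixPointInterpolation.lean`
(TWO-LAYER PLAN), typed and composed with the PROVED support item `PointCount`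
(`Theorems.pointCount_proof`).

* `stub_fastMasquerades` — FAST MASQUERADES (open core): for every accuracy `ε > 0` a point size
  `k ≥ 1` such that for arbitrarily large `n` some pair `A ∈ M_n(ℂ)²` generates `M_n` by words of
  length `≤ d`, satisfies every two-letter identity of `M_k` of degree `≤ 2d`, and does so FAST:
  `(2d+1)^(k²+1) ≤ n^(2+ε)`.  Since a masquerade forces `n² ≤ genericWordDim k (2d) ≍ (2d)^(k²+1)`
  (the evaluation map from the word functions on `M_k(ℂ)²` onto `W_{2d}(A) = M_n` is well defined and
  surjective), this is generation at the generic speed of `k × k` matrices, up to `n^ε`.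
* `stub_genericGrowthPolyUpper` — polynomial UPPER growth of two generic `k × k` matrices with the
  sharp exponent: `genericWordDim k D ≤ K_k · (D+1)^(k²+1)`.  Elementary (restriction to the
  `(k²+1)`-parameter slice `X = diag(x₁,…,x_k)`, `y_{i,i+1} = 1`, which meets a dense set of
  conjugation orbits; word maps are conjugation-equivariant polynomial maps), and also a one-line
  corollary of the vendored named fact
  `Literature.Algebra.PolynomialIdentities.GenericMatricesQuasiPolynomialGrowth` via `.upper_of_one_le`
  with `g = j` (Procesi 1967: `GKdim = (ℓ-1)k² + 1 = k² + 1` for `ℓ = 2` generic matrices, quoted in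
  Kanel-Belov–Karasik–Rowen 2015, §11.2.5; rational Hilbert series §11.3).
* `FewPointMasquerades_of` — the kernel-checked composition: points from `pointCount_proof`
  (`N ≤ genericWordDim k (2d)`, definitionally), then
  `N ≤ K (2d+1)^(k²+1) ≤ K n^(2+ε/2) ≤ n^(ε/2) · n^(2+ε/2) = n^(2+ε)` for `n` large.
-/

set_option linter.dupNamespace false

namespace Summit.MatrixMultiplication.MatrixMultiplication.Cruxes.FewPointMasquerades.FastMasquerades

open scoped BigOperators
open Summit.MatrixMultiplication.MatrixMultiplication.Theses.MatrixPointInterpolation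
  (FewPointMasquerades PointCount)
open Literature.Algebra.PolynomialIdentities (genericWordDim)

/-! ## Vocabulary (bodies literally those of the route decls) -/

/-- `Gen n d A`: the words of length `≤ d` in the pair `A` span `M_n(ℂ)` (literally the generation
conjunct of `FewPointMasquerades` / `LongMasquerade`). -/
def Gen (n d : ℕ) (A : Fin 2 → Matrix (Fin n) (Fin n) ℂ) : Prop :=
  Submodule.span ℂ {M : Matrix (Fin n) (Fin n) ℂ |
    ∃ w : List (Fin 2), w.length ≤ d ∧ (w.map A).prod = M} = ⊤

/-- `Masq n k D A`: the pair `A ∈ M_n(ℂ)²` satisfies every linear combination of words of length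
`≤ D` that vanishes on all pairs of `k × k` matrices (literally the hypothesis of `PointCount` with
`D = 2d`). -/
def Masq (n k D : ℕ) (A : Fin 2 → Matrix (Fin n) (Fin n) ℂ) : Prop :=
  ∀ (T : Finset (List (Fin 2))) (c : List (Fin 2) → ℂ), (∀ w ∈ T, w.length ≤ D) →
    (∀ B : Fin 2 → Matrix (Fin k) (Fin k) ℂ, (∑ w ∈ T, c w • (w.map B).prod) = 0) →
    (∑ w ∈ T, c w • (w.map A).prod) = 0

/-- **FastMasquerades** (statement of `stub_fastMasquerades`).  For every `ε > 0` there is a point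
size `k ≥ 1` such that for every `n₀` some pair `A ∈ M_n(ℂ)²`, `n ≥ n₀`, generates `M_n` in degree
`d`, masquerades as `M_k` to degree `2d`, and `(2d+1)^(k²+1) ≤ n^(2+ε)`. -/
def FastMasquerades : Prop :=
  ∀ ε : ℝ, 0 < ε → ∃ k : ℕ, 1 ≤ k ∧ ∀ n₀ : ℕ, ∃ (n d : ℕ) (A : Fin 2 → Matrix (Fin n) (Fin n) ℂ),
    n₀ ≤ n ∧ ((2 * d + 1 : ℕ) : ℝ) ^ (k ^ 2 + 1) ≤ (n : ℝ) ^ ((2 : ℝ) + ε) ∧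
    Gen n d A ∧ Masq n k (2 * d) A

/-- **GenericGrowthPolyUpper** (statement of `stub_genericGrowthPolyUpper`).  Polynomial upper bound
with the sharp exponent for the degree filtration of two generic `k × k` matrices:
`genericWordDim k D ≤ K · (D+1)^(k²+1)` for all `D`, some `K = K(k) > 0`. -/
def GenericGrowthPolyUpper : Prop :=
  ∀ k : ℕ, 1 ≤ k → ∃ K : ℝ, 0 < K ∧ ∀ D : ℕ,
    (genericWordDim k D : ℝ) ≤ K * ((D + 1 : ℕ) : ℝ) ^ (k ^ 2 + 1)

/-! ## Registered stubs -/

/-- STUB (open core, XL).  Fast masquerades exist.  Why plausibly true: masquerades with `n → ∞`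
at fixed `k` exist (`LongMasquerade`, `k = 5`, corner/shift pair, but SLOW: `d = 2n`, window
`≥ n⁴`); the anti-Riemann–Roch inequality `n² ≤ K₁ g d^(k²)` (TightWindows/Negative/LooseMasquerades)
permits exactly this speed and no faster; hosts: near-generic quotients `ℂ⟨x,y⟩/(T₂(M_k)_{≤2d} + I)`
of dimension `n²`, deformations of pairs of generic matrices.  Why it might fail: a windowed
Kaplansky theorem at generic speed (identities of degree `≤ 2d` plus generation in degree `d` with
`d^(k²+1) ≈ n²` could force a proper invariant subspace). -/
theorem stub_fastMasquerades : FastMasquerades := by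
  sorry

/-- STUB (classical, L).  `genericWordDim k D = O_k((D+1)^(k²+1))` — Procesi's `GKdim = k² + 1` in
its elementary upper-bound half (slice argument), or from the vendored named fact
`GenericMatricesQuasiPolynomialGrowth.upper_of_one_le` (take `g = j = D`, `d̃_0 ≤ 4`). -/
theorem stub_genericGrowthPolyUpper : GenericGrowthPolyUpper := by
  sorry

/-! ## Composition -/

/-- **The line closes the crux.**  `FastMasquerades → GenericGrowthPolyUpper → FewPointMasquerades`:
the points are the `N ≤ genericWordDim k (2d)` evaluation places of the proved `PointCount`, and
`N ≤ K (2d+1)^(k²+1) ≤ K n^(2+ε/2) ≤ n^(2+ε)` once `n^(ε/2) ≥ K`. -/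
theorem FewPointMasquerades_of (hF : FastMasquerades) (hG : GenericGrowthPolyUpper) :
    FewPointMasquerades := by
  intro ε hε
  obtain ⟨k, hk, hFk⟩ := hF (ε / 2) (by positivity)
  obtain ⟨K, hK, hKD⟩ := hG k hk
  refine ⟨k, fun n₀ => ?_⟩
  -- a threshold beyond which `K ≤ n ^ (ε/2)`
  obtain ⟨x₀, hx₀⟩ : ∃ x₀ : ℝ, ∀ x ≥ x₀, K ≤ x ^ (ε / 2) :=
    Filter.eventually_atTop.mp
      ((tendsto_rpow_atTop (by positivity : 0 < ε / 2)).eventually_ge_atTop K)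
  obtain ⟨n, d, A, hn, hsize, hgen, hmasq⟩ := hFk (max n₀ (max 1 ⌈x₀⌉₊))
  have hPC : PointCount := Theorems.pointCount_proof
  obtain ⟨N, B, hN, hB⟩ := hPC n k d A hmasq
  refine ⟨n, d, N, A, B, le_trans (le_max_left _ _) hn, ?_, hgen, hB⟩
  have hn1 : 1 ≤ n := le_trans (le_trans (le_max_left _ _) (le_max_right _ _)) hn
  have hn0 : (0 : ℝ) < n := by exact_mod_cast hn1
  have hnx : x₀ ≤ (n : ℝ) := by
    have h : ⌈x₀⌉₊ ≤ n := le_trans (le_trans (le_max_right _ _) (le_max_right _ _)) hn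
    exact le_trans (Nat.le_ceil x₀) (by exact_mod_cast h)
  have h1 : (N : ℝ) ≤ genericWordDim k (2 * d) := by exact_mod_cast hN
  have h2 := hKD (2 * d)
  have h3 : K ≤ (n : ℝ) ^ (ε / 2) := hx₀ _ hnx
  have hpos : (0 : ℝ) ≤ (n : ℝ) ^ ((2 : ℝ) + ε / 2) := by positivity
  calc (N : ℝ) ≤ genericWordDim k (2 * d) := h1
    _ ≤ K * ((2 * d + 1 : ℕ) : ℝ) ^ (k ^ 2 + 1) := h2
    _ ≤ K * (n : ℝ) ^ ((2 : ℝ) + ε / 2) := mul_le_mul_of_nonneg_left hsize hK.le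
    _ ≤ (n : ℝ) ^ (ε / 2) * (n : ℝ) ^ ((2 : ℝ) + ε / 2) := mul_le_mul_of_nonneg_right h3 hpos
    _ = (n : ℝ) ^ ((2 : ℝ) + ε) := by
        rw [← Real.rpow_add hn0]
        congr 1
        ring

/-- The crux from the two registered stubs (by name). -/
theorem FewPointMasquerades_of_stubs : FewPointMasquerades :=
  FewPointMasquerades_of stub_fastMasquerades stub_genericGrowthPolyUpper

end Summit.MatrixMultiplication.MatrixMultiplication.Cruxes.FewPointMasquerades.FastMasquerades
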